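import Literature.NumberTheory.Transcendental.ZilberFieldProofs
import Literature.NumberTheory.Transcendental.ZilberFieldQuasiminimal
import HarnessLib

/-!
# Zilber's axioms are invariant under isomorphisms of exponential fields

Sibling proof file of `Literature/NumberTheory/Transcendental/ZilberField.lean`.

B. Zilber, *Pseudo-exponentiation on algebraically closed fields of characteristic zero*, Ann. Pure
Appl. Logic 132 (2005) 67–95, Thm 1.1, classifies the fields with pseudo-exponentiation *up to
isomorphism of exponential fields*; M. Bays, J. Kirby, *Pseudo-exponential maps, variants, and
quasiminimality*, Algebra & Number Theory 12 (2018) 493–549, Thm 1.2 (= Thm 9.1, p. 28): "Up to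
isomorphism there is exactly one model of the axioms `ECF_{SK,CCP}` of each uncountable
cardinality", and Conjecture 1.3: "`ℂ_exp` is isomorphic to the unique model `𝔹` of `ECF_{SK,CCP}`
of cardinality continuum". Reading Conjecture 1.3 as a statement about `ℂ_exp` itself
(`Literature.NumberTheory.Transcendental.zilberConjecture_iff_forall_nonempty_equiv`, file
`Zilber.lean`) uses the (tacit, elementary) fact that the axioms `ECF_{SK,CCP}` — in the tree the
hypothesis structure `Literature.NumberTheory.Transcendental.IsZilberField` — are preserved by
E-ring isomorphisms. This file PROVES that transport:

* `Literature.NumberTheory.Transcendental.IsZilberField.of_exponentialRingEquiv` — if `K` is a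
  Zilber field and `e : K ≃ K'` is an isomorphism of exponential rings
  (`Literature.NumberTheory.Transcendental.ExponentialRingEquiv`), then `K'` is a Zilber field;
  `Literature.NumberTheory.Transcendental.ExponentialRingEquiv.isZilberField_iff`.

axiom by axiom:

* `IsAlgClosed` — `Literature.NumberTheory.Transcendental.isAlgClosed_of_ringEquiv` (roots of
  `p` in `K'` are images of roots of `p.map e⁻¹` in `K`; Mathlib's `IsAlgClosed.of_ringEquiv` is the
  same-universe case);
* standard kernel — `HasStandardKernel.of_exponentialRingEquiv` (`ZilberFieldProofs.lean`);
* surjectivity of `exp` — `IsSurjectiveOntoUnits.of_exponentialRingEquiv` below;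
* Schanuel property — `Literature.ModelTheory.ExponentialFields.SchanuelProperty.of_injective_holds`
  (`ExponentialField.lean`) applied to the embedding `e⁻¹ : K' → K`;
* strong exponential-algebraic closedness —
  `IsStronglyExpAlgClosed.of_exponentialRingEquiv` below, from the transport of the
  algebraic-geometry vocabulary of `ExpVarieties.lean` along a ring isomorphism `e : K ≃+* K'`
  acting coordinatewise on affine space (`z ↦ e ∘ z`): zero loci and vanishing ideals
  (`image_comp_zeroLocus`, `vanishingIdeal_image_comp`), Zariski dimension
  (`zariskiDim_image_comp`, via `Ideal.quotientEquiv` and `ringKrullDim_eq_of_ringEquiv`),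
  irreducibility, the torus locus, the action `[M]` of integer matrices (`comp_matrixAct`),
  rotundity, additive/multiplicative freeness, fields of definition and generic points over a
  subfield `F ≤ K` versus its image `F.map e ≤ K'` (`IsDefinedOver.image_comp`,
  `IsGenericOver.image_comp`, through the coefficient-wise descriptions
  `isDefinedOver_iff_exists_subset_range`, `isGenericOver_iff_forall_range`), and the graph of
  exponentiation (`image_comp_expGraph`);
* countable closure property — `HasCountableClosureProperty.of_exponentialRingEquiv`, from
  `Khovanskii.image_ecl_equiv` (`ZilberFieldQuasiminimal.lean`: `e (ecl A) = ecl (e A)`).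

All statements here are elementary ("transport of structure") and carry `[folklore]`; the
sources above are where the invariance is used. Nothing in this file is specific to `ℂ`.

## References

* B. Zilber, *Pseudo-exponentiation on algebraically closed fields of characteristic zero*,
  Ann. Pure Appl. Logic 132 (2005) 67–95, Thm 1.1.
* M. Bays, J. Kirby, *Pseudo-exponential maps, variants, and quasiminimality*, Algebra & Number
  Theory 12 (2018) 493–549 (arXiv:1512.04262), Thm 1.2, Conjecture 1.3, Thm 9.1.
* J. Kirby, *A note on the axioms for Zilber's pseudo-exponential fields*, Notre Dame J. Formal
  Logic 54 (2013) 509–520, §2.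
-/

noncomputable section

open MvPolynomial Cardinal Set
open Literature.ModelTheory.ExponentialFields

namespace Literature.NumberTheory.Transcendental

universe u v

/-! ### Ring isomorphisms acting on affine space, zero loci and dimension -/

section RingEquivTransport

variable {K : Type u} {K' : Type v} [Field K] [Field K'] {ι : Type*}

/-- Algebraic closedness is invariant under ring isomorphisms (any universes): a monic
irreducible `p ∈ K'[X]` has the root `e x`, where `x ∈ K` is a root of `p.map e⁻¹`. (Mathlib's
`IsAlgClosed.of_ringEquiv` is the same-universe case.) [folklore] -/
theorem isAlgClosed_of_ringEquiv (e : K ≃+* K') (h : IsAlgClosed K) : IsAlgClosed K' := by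
  refine IsAlgClosed.of_exists_root K' fun p _ hirr => ?_
  have hdeg : (p.map (e.symm : K' →+* K)).degree ≠ 0 := by
    rw [Polynomial.degree_map]
    exact (Polynomial.degree_pos_of_irreducible hirr).ne'
  obtain ⟨x, hx⟩ := IsAlgClosed.exists_root (p.map (e.symm : K' →+* K)) hdeg
  refine ⟨e x, ?_⟩
  rw [Polynomial.IsRoot.def, Polynomial.eval_map] at hx
  have := congr_arg (e : K →+* K') hx
  rw [Polynomial.hom_eval₂, map_zero, RingEquiv.comp_symm] at this
  exact this

/-- Evaluation commutes with a ring isomorphism acting on points and coefficients: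
`(e p)(e ∘ z) = e (p z)`. [folklore] -/
theorem aeval_comp_map_ringEquiv (e : K ≃+* K') (z : ι → K) (p : MvPolynomial ι K) :
    aeval (⇑e ∘ z) (map (e : K →+* K') p) = e (aeval z p) := by
  induction p using MvPolynomial.induction_on with
  | C a => simp
  | add p q hp hq => simp only [map_add, hp, hq]
  | mul_X p i hp => simp only [map_mul, map_X, hp, aeval_X, Function.comp_apply]

/-- `e⁻¹ ∘ (e ∘ z) = z`. [folklore] -/
@[simp] theorem symm_comp_self_comp (e : K ≃+* K') (z : ι → K) : ⇑e.symm ∘ (⇑e ∘ z) = z := by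
  funext i; simp

/-- `e ∘ (e⁻¹ ∘ z') = z'`. [folklore] -/
@[simp] theorem self_comp_symm_comp (e : K ≃+* K') (z' : ι → K') : ⇑e ∘ (⇑e.symm ∘ z') = z' := by
  funext i; simp

/-- Membership in the coordinatewise image: `z' ∈ e(S) ↔ e⁻¹ ∘ z' ∈ S`. [folklore] -/
theorem mem_image_comp_ringEquiv_iff (e : K ≃+* K') {S : Set (ι → K)} {z' : ι → K'} :
    z' ∈ (fun z : ι → K => ⇑e ∘ z) '' S ↔ ⇑e.symm ∘ z' ∈ S := by
  constructor
  · rintro ⟨z, hz, rfl⟩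
    rwa [symm_comp_self_comp]
  · intro h
    exact ⟨_, h, self_comp_symm_comp e z'⟩

/-- The coordinatewise action of a ring isomorphism on affine space is injective. [folklore] -/
theorem comp_ringEquiv_injective (e : K ≃+* K') : Function.Injective (fun z : ι → K => ⇑e ∘ z) :=
  e.injective.comp_left

/-- `e (e⁻¹ (S')) = S'` for the coordinatewise action on affine space. [folklore] -/
theorem image_comp_image_comp_symm (e : K ≃+* K') (S' : Set (ι → K')) :
    (fun z : ι → K => ⇑e ∘ z) '' ((fun z' : ι → K' => ⇑e.symm ∘ z') '' S') = S' := by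
  rw [Set.image_image]
  simp

/-- The coordinatewise image of a zero locus is the zero locus of the transported polynomials:
`e(Z(I)) = Z(e I)`. [folklore] -/
theorem image_comp_zeroLocus (e : K ≃+* K') (I : Ideal (MvPolynomial ι K)) :
    (fun z : ι → K => ⇑e ∘ z) '' zeroLocus K I =
      zeroLocus K' (Ideal.span (map (e : K →+* K') '' (I : Set (MvPolynomial ι K)))) := by
  ext z'
  rw [mem_image_comp_ringEquiv_iff, zeroLocus_span, mem_zeroLocus_iff, Set.mem_setOf_eq,
    Set.forall_mem_image]
  refine forall₂_congr fun p _ => ?_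
  conv_rhs => rw [← self_comp_symm_comp e z', aeval_comp_map_ringEquiv]
  rw [EmbeddingLike.map_eq_zero_iff (f := e)]

/-- Zariski closedness is preserved by the coordinatewise action of a ring isomorphism.
[folklore] -/
theorem IsZariskiClosed.image_comp (e : K ≃+* K') {S : Set (ι → K)} (h : IsZariskiClosed K S) :
    IsZariskiClosed K' ((fun z : ι → K => ⇑e ∘ z) '' S) := by
  obtain ⟨I, rfl⟩ := h
  exact ⟨_, image_comp_zeroLocus e I⟩

/-- The vanishing ideal of the coordinatewise image is the image of the vanishing ideal under the
induced isomorphism `K[X] ≃ K'[X]` of polynomial rings: `I(e S) = e (I(S))`. [folklore] -/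
theorem vanishingIdeal_image_comp (e : K ≃+* K') (S : Set (ι → K)) :
    vanishingIdeal K' ((fun z : ι → K => ⇑e ∘ z) '' S) =
      (vanishingIdeal K S).map ((mapEquiv ι e : MvPolynomial ι K ≃+* MvPolynomial ι K') :
        MvPolynomial ι K →+* MvPolynomial ι K') := by
  rw [Ideal.map_comap_of_equiv]
  ext p
  rw [Ideal.mem_comap, mem_vanishingIdeal_iff, mem_vanishingIdeal_iff, Set.forall_mem_image]
  refine forall₂_congr fun z _ => ?_
  rw [mapEquiv_symm, mapEquiv_apply]
  conv_rhs => rw [← symm_comp_self_comp e z, aeval_comp_map_ringEquiv]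
  rw [EmbeddingLike.map_eq_zero_iff (f := e.symm)]

/-- **Zariski dimension is invariant under isomorphisms of the ground field** acting
coordinatewise: the coordinate rings `K[X]/I(S)` and `K'[X]/I(e S)` are isomorphic
(`Ideal.quotientEquiv`), so they have the same Krull dimension. [folklore] -/
theorem zariskiDim_image_comp (e : K ≃+* K') (S : Set (ι → K)) :
    zariskiDim K' ((fun z : ι → K => ⇑e ∘ z) '' S) = zariskiDim K S := by
  unfold zariskiDim
  exact (ringKrullDim_eq_of_ringEquiv (Ideal.quotientEquiv (vanishingIdeal K S) _ (mapEquiv ι e)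
    (vanishingIdeal_image_comp e S))).symm

/-- Irreducible Zariski closed sets (affine varieties) are preserved by the coordinatewise action
of a ring isomorphism: the vanishing ideal of the image is the image of a prime ideal under a ring
isomorphism. [folklore] -/
theorem IsIrreducibleClosed.image_comp (e : K ≃+* K') {S : Set (ι → K)}
    (h : IsIrreducibleClosed K S) :
    IsIrreducibleClosed K' ((fun z : ι → K => ⇑e ∘ z) '' S) := by
  refine ⟨h.1.image_comp e, ?_⟩
  rw [vanishingIdeal_image_comp, Ideal.map_comap_of_equiv]
  haveI := h.2
  infer_instance

/-! ### Fields of definition and generic points -/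

/-- The range of `F ↪ K` for a subfield `F ≤ K` is `F`. [folklore] -/
theorem range_algebraMap_subfield (F : Subfield K) : Set.range (algebraMap F K) = F := by
  ext x
  exact ⟨fun ⟨y, hy⟩ => hy ▸ y.2, fun hx => ⟨⟨x, hx⟩, rfl⟩⟩

/-- A polynomial with coefficients in `F ≤ K`, transported by `e`, has coefficients in any
subfield `F' ≤ K'` containing `e(F)`. [folklore] -/
theorem map_mem_range_map_algebraMap (e : K ≃+* K') {F : Subfield K} {F' : Subfield K'}
    (hF : F.map (e : K →+* K') ≤ F') {p : MvPolynomial ι K}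
    (hp : p ∈ Set.range (map (algebraMap F K))) :
    map (e : K →+* K') p ∈ Set.range (map (algebraMap F' K')) := by
  rw [mem_range_map_iff_coeffs_subset, range_algebraMap_subfield] at hp ⊢
  intro c hc
  obtain ⟨c₀, hc₀, rfl⟩ := coe_coeffs_map _ p hc
  exact hF (Subfield.mem_map.mpr ⟨c₀, hp hc₀, rfl⟩)

/-- **Fields of definition, coefficientwise.** `S` is (closed and) defined over the subfield
`F ≤ K` iff it is cut out by polynomials over `K` all of whose coefficients lie in `F`
(equivalently, polynomials in the range of `F[X] → K[X]`). [folklore] -/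
theorem isDefinedOver_iff_exists_subset_range {F : Subfield K} {S : Set (ι → K)} :
    IsDefinedOver F S ↔ ∃ T : Set (MvPolynomial ι K),
      T ⊆ Set.range (map (algebraMap F K)) ∧ S = {z | ∀ p ∈ T, aeval z p = 0} := by
  constructor
  · rintro ⟨I, rfl⟩
    refine ⟨map (algebraMap F K) '' (I : Set (MvPolynomial ι F)), ?_, ?_⟩
    · rintro _ ⟨q, -, rfl⟩
      exact ⟨q, rfl⟩
    · ext z
      rw [mem_zeroLocus_iff, Set.mem_setOf_eq, Set.forall_mem_image]
      refine forall₂_congr fun q _ => ?_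
      rw [aeval_map_algebraMap]
  · rintro ⟨T, hT, rfl⟩
    refine ⟨Ideal.span {q | map (algebraMap F K) q ∈ T}, ?_⟩
    ext z
    rw [zeroLocus_span, Set.mem_setOf_eq, Set.mem_setOf_eq]
    constructor
    · intro h q hq
      rw [← aeval_map_algebraMap K]
      exact h _ hq
    · intro h p hp
      obtain ⟨q, rfl⟩ := hT hp
      rw [aeval_map_algebraMap]
      exact h q hp

/-- **Transport of fields of definition**: if `S ⊆ K^ι` is defined over `F ≤ K` and
`e : K ≃ K'`, then `e(S)` is defined over any subfield `F' ≤ K'` containing `e(F)`. [folklore] -/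
theorem IsDefinedOver.image_comp (e : K ≃+* K') {F : Subfield K} {F' : Subfield K'}
    (hF : F.map (e : K →+* K') ≤ F') {S : Set (ι → K)} (h : IsDefinedOver F S) :
    IsDefinedOver F' ((fun z : ι → K => ⇑e ∘ z) '' S) := by
  rw [isDefinedOver_iff_exists_subset_range] at h ⊢
  obtain ⟨T, hT, rfl⟩ := h
  refine ⟨map (e : K →+* K') '' T, ?_, ?_⟩
  · rintro _ ⟨p, hp, rfl⟩
    exact map_mem_range_map_algebraMap e hF (hT hp)
  · ext z'
    rw [mem_image_comp_ringEquiv_iff, Set.mem_setOf_eq, Set.mem_setOf_eq, Set.forall_mem_image]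
    refine forall₂_congr fun p _ => ?_
    conv_rhs => rw [← self_comp_symm_comp e z', aeval_comp_map_ringEquiv]
    rw [EmbeddingLike.map_eq_zero_iff (f := e)]

/-- **Generic points, coefficientwise.** `z` is generic in `V` over `F ≤ K` iff `z ∈ V` and every
polynomial over `K` with coefficients in `F` vanishing at `z` vanishes on `V` (the inclusion
`I_F(V) ⊆ I_F(z)` being automatic). [folklore] -/
theorem isGenericOver_iff_forall_range {F : Subfield K} {V : Set (ι → K)} {z : ι → K} :
    IsGenericOver F V z ↔ z ∈ V ∧ ∀ p ∈ Set.range (map (algebraMap F K)),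
      aeval z p = 0 → ∀ w ∈ V, aeval w p = 0 := by
  refine and_congr_right fun hz => ?_
  constructor
  · rintro h _ ⟨q, rfl⟩ hq w hw
    rw [aeval_map_algebraMap] at hq ⊢
    have hmem : q ∈ vanishingIdeal F ({z} : Set (ι → K)) :=
      (mem_vanishingIdeal_singleton_iff z q).mpr hq
    rw [h] at hmem
    exact hmem w hw
  · intro h
    ext q
    rw [mem_vanishingIdeal_singleton_iff, mem_vanishingIdeal_iff]
    constructor
    · intro hq w hw
      have := h _ ⟨q, rfl⟩ (by rwa [aeval_map_algebraMap]) w hw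
      rwa [aeval_map_algebraMap] at this
    · intro hq
      exact hq z hz

/-- **Transport of generic points**: if `z` is generic in `V` over `F ≤ K` and `e : K ≃ K'`, then
`e ∘ z` is generic in `e(V)` over any subfield `F' ≤ K'` with `e⁻¹(F') ⊆ F`. [folklore] -/
theorem IsGenericOver.image_comp (e : K ≃+* K') {F : Subfield K} {F' : Subfield K'}
    (hF' : F'.map (e.symm : K' →+* K) ≤ F) {V : Set (ι → K)} {z : ι → K}
    (h : IsGenericOver F V z) :
    IsGenericOver F' ((fun w : ι → K => ⇑e ∘ w) '' V) (⇑e ∘ z) := by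
  rw [isGenericOver_iff_forall_range] at h ⊢
  refine ⟨⟨z, h.1, rfl⟩, fun p' hp' hz' => ?_⟩
  rw [Set.forall_mem_image]
  intro w hw
  have key : ∀ w : ι → K,
      aeval w (map (e.symm : K' →+* K) p') = e.symm (aeval (⇑e ∘ w) p') := fun w => by
    conv_lhs => rw [← symm_comp_self_comp e w]
    exact aeval_comp_map_ringEquiv e.symm (⇑e ∘ w) p'
  have h0 : aeval z (map (e.symm : K' →+* K) p') = 0 := by rw [key, hz', map_zero]
  have := h.2 _ (map_mem_range_map_algebraMap e.symm hF' hp') h0 w hw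
  rwa [key, EmbeddingLike.map_eq_zero_iff (f := e.symm)] at this

/-! ### The torus locus, the action of integer matrices, rotundity and freeness -/

variable {n : ℕ}

/-- The coordinatewise action of a ring isomorphism preserves `Kⁿ × (Kˣ)ⁿ`. [folklore] -/
theorem image_comp_torusLocus (e : K ≃+* K') :
    (fun z : Fin n ⊕ Fin n → K => ⇑e ∘ z) '' torusLocus K n = torusLocus K' n := by
  ext z'
  rw [mem_image_comp_ringEquiv_iff, mem_torusLocus_iff, mem_torusLocus_iff]
  simp

/-- The coordinatewise action of a ring isomorphism commutes with intersections. [folklore] -/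
theorem image_comp_inter (e : K ≃+* K') (S T : Set (ι → K)) :
    (fun z : ι → K => ⇑e ∘ z) '' (S ∩ T) =
      (fun z : ι → K => ⇑e ∘ z) '' S ∩ (fun z : ι → K => ⇑e ∘ z) '' T :=
  Set.image_inter (comp_ringEquiv_injective e)

/-- A ring isomorphism commutes with the action `[M]` of an integer matrix on `Kⁿ × (Kˣ)ⁿ`
(integer linear combinations on the additive block, Laurent monomials on the multiplicative
block). [folklore] -/
theorem comp_matrixAct (e : K ≃+* K') (M : Matrix (Fin n) (Fin n) ℤ) (z : Fin n ⊕ Fin n → K) :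
    ⇑e ∘ matrixAct M z = matrixAct M (⇑e ∘ z) := by
  funext s
  rcases s with i | i
  · simp [matrixAct_inl, map_sum]
  · simp [matrixAct_inr, map_prod]

/-- `e([M] V) = [M] e(V)`. [folklore] -/
theorem image_comp_image_matrixAct (e : K ≃+* K') (M : Matrix (Fin n) (Fin n) ℤ)
    (V : Set (Fin n ⊕ Fin n → K)) :
    (fun z : Fin n ⊕ Fin n → K => ⇑e ∘ z) '' (matrixAct M '' V) =
      matrixAct M '' ((fun z : Fin n ⊕ Fin n → K => ⇑e ∘ z) '' V) := by
  rw [Set.image_image, Set.image_image]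
  simp_rw [comp_matrixAct]

/-- **Rotundity is invariant** under isomorphisms of the ground field acting coordinatewise
(`dim [M] e(V) = dim e([M] V) = dim [M] V`). [folklore] -/
theorem IsRotund.image_comp (e : K ≃+* K') {V : Set (Fin n ⊕ Fin n → K)} (h : IsRotund K n V) :
    IsRotund K' n ((fun z : Fin n ⊕ Fin n → K => ⇑e ∘ z) '' V) := fun M => by
  rw [← image_comp_image_matrixAct, zariskiDim_image_comp]
  exact h M

/-- **Additive freeness is invariant** under isomorphisms of the ground field acting
coordinatewise. [folklore] -/
theorem IsAddFree.image_comp (e : K ≃+* K') {V : Set (Fin n ⊕ Fin n → K)} (h : IsAddFree K n V) :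
    IsAddFree K' n ((fun z : Fin n ⊕ Fin n → K => ⇑e ∘ z) '' V) := by
  rintro m hm ⟨c, hc⟩
  refine h m hm ⟨e.symm c, fun z hz => ?_⟩
  have hz' := hc (⇑e ∘ z) ⟨z, hz, rfl⟩
  apply e.injective
  rw [e.apply_symm_apply, ← hz', map_sum]
  simp [map_mul]

/-- **Multiplicative freeness is invariant** under isomorphisms of the ground field acting
coordinatewise. [folklore] -/
theorem IsMulFree.image_comp (e : K ≃+* K') {V : Set (Fin n ⊕ Fin n → K)} (h : IsMulFree K n V) :
    IsMulFree K' n ((fun z : Fin n ⊕ Fin n → K => ⇑e ∘ z) '' V) := by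
  rintro m hm ⟨c, hc⟩
  refine h m hm ⟨e.symm c, fun z hz => ?_⟩
  have hz' := hc (⇑e ∘ z) ⟨z, hz, rfl⟩
  apply e.injective
  rw [e.apply_symm_apply, ← hz', map_prod]
  simp

end RingEquivTransport

/-! ### Isomorphisms of exponential fields -/

section ERingTransport

variable {K : Type u} {K' : Type v} [Field K] [Field K'] [ExponentialRing K] [ExponentialRing K']
  {n : ℕ}

/-- The inverse of an E-ring isomorphism, as a ring isomorphism. [folklore] -/
@[simp] theorem ExponentialRingEquiv.toRingEquiv_symm (e : ExponentialRingEquiv K K') :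
    e.toRingEquiv.symm = e.symm.toRingEquiv := rfl

/-- An isomorphism of exponential fields maps the graph of exponentiation onto the graph of
exponentiation. [folklore] -/
theorem image_comp_expGraph (e : ExponentialRingEquiv K K') :
    (fun z : Fin n ⊕ Fin n → K => ⇑e.toRingEquiv ∘ z) '' expGraph K n = expGraph K' n := by
  ext z'
  rw [mem_image_comp_ringEquiv_iff, mem_expGraph_iff, mem_expGraph_iff]
  refine forall_congr' fun i => ?_
  simp only [ExponentialRingEquiv.toRingEquiv_symm, Function.comp_apply,
    ExponentialRingEquiv.coe_toRingEquiv]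
  rw [← e.symm.map_exp, (EquivLike.injective e.symm).eq_iff]

/-- **Surjectivity of `exp` onto the units is invariant** under isomorphisms of exponential
fields. (A deliberate dot-notation extension of
`Literature.ModelTheory.ExponentialFields.ExponentialRing.IsSurjectiveOntoUnits`, which lives in
`ExponentialField.lean` below `ExponentialRingEquiv`.) [folklore] -/
theorem _root_.Literature.ModelTheory.ExponentialFields.ExponentialRing.IsSurjectiveOntoUnits.of_exponentialRingEquiv
    (e : ExponentialRingEquiv K K') (h : ExponentialRing.IsSurjectiveOntoUnits K) :
    ExponentialRing.IsSurjectiveOntoUnits K' := by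
  intro y hy
  obtain ⟨x, hx⟩ := h (e.symm y) (by simpa using hy)
  refine ⟨e x, ?_⟩
  rw [← e.map_exp, hx, e.apply_symm_apply]

/-- **The countable closure property is invariant** under isomorphisms of exponential fields:
`ecl` is transported by E-ring isomorphisms (`Khovanskii.image_ecl_equiv`), so
`ecl_{K'}(A) = e (ecl_K (e⁻¹ A))` is countable for countable `A`. [folklore] -/
theorem HasCountableClosureProperty.of_exponentialRingEquiv (e : ExponentialRingEquiv K K')
    (h : HasCountableClosureProperty K) :
    HasCountableClosureProperty K' := by
  intro A hA
  have h1 : (ecl (e.symm '' A)).Countable := h _ (hA.image _)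
  have h2 := h1.image e
  rw [Khovanskii.image_ecl_equiv, Set.image_image] at h2
  simpa using h2

/-- **Strong exponential-algebraic closedness is invariant** under isomorphisms of exponential
fields. Given the data over `K'` (a variety `V' = W' ∩ Gⁿ` presented by its closure `W'`, finite
sets `A', F₀'`), pull everything back to `K` along `e⁻¹` — irreducibility, non-emptiness of
`W ∩ Gⁿ`, rotundity, freeness, dimension and the field of definition `ℚ(e⁻¹ F₀')` are transported
by the lemmas above — apply SEAC in `K`, and push the generic point `(x, eˣ)` forward along `e`:
it lies on `W'` and on the graph of `exp` (`e` commutes with `exp`), and it is generic over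
`ℚ(A' ∪ F₀') = e(ℚ(e⁻¹A' ∪ e⁻¹F₀'))`. [folklore] -/
theorem IsStronglyExpAlgClosed.of_exponentialRingEquiv (e : ExponentialRingEquiv K K')
    (h : IsStronglyExpAlgClosed K) :
    IsStronglyExpAlgClosed K' := by
  classical
  intro n W' hirr' hne' hrot' hadd' hmul' hdim' A' F₀' hdef'
  set ε : K ≃+* K' := e.toRingEquiv with hε
  -- pull the data back to `K` along `ε⁻¹`
  set W : Set (Fin n ⊕ Fin n → K) := (fun z' : Fin n ⊕ Fin n → K' => ⇑ε.symm ∘ z') '' W' with hW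
  have hWimg : (fun z : Fin n ⊕ Fin n → K => ⇑ε ∘ z) '' W = W' := image_comp_image_comp_symm ε W'
  have hT : (fun z' : Fin n ⊕ Fin n → K' => ⇑ε.symm ∘ z') '' (W' ∩ torusLocus K' n) =
      W ∩ torusLocus K n := by
    rw [image_comp_inter, image_comp_torusLocus]
  have hirr : IsIrreducibleClosed K W := hirr'.image_comp ε.symm
  have hne : (W ∩ torusLocus K n).Nonempty := by
    rw [← hT]
    exact hne'.image _
  have hrot : IsRotund K n (W ∩ torusLocus K n) := by
    rw [← hT]
    exact hrot'.image_comp ε.symm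
  have hadd : IsAddFree K n (W ∩ torusLocus K n) := by
    rw [← hT]
    exact hadd'.image_comp ε.symm
  have hmul : IsMulFree K n (W ∩ torusLocus K n) := by
    rw [← hT]
    exact hmul'.image_comp ε.symm
  have hdim : zariskiDim K W = n := by
    rw [hW, zariskiDim_image_comp]
    exact hdim'
  -- fields of definition: `ℚ(ε⁻¹ F₀')` and `ℚ(ε⁻¹ A' ∪ ε⁻¹ F₀')`
  have hF₀ : (Subfield.closure (↑F₀' : Set K')).map (ε.symm : K' →+* K) ≤
      Subfield.closure (↑(F₀'.image ε.symm) : Set K) := by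
    rw [RingHom.map_field_closure, Finset.coe_image]
    rfl
  have hF : (Subfield.closure (↑A' ∪ ↑F₀' : Set K')).map (ε.symm : K' →+* K) ≤
      Subfield.closure (↑(A'.image ε.symm) ∪ ↑(F₀'.image ε.symm) : Set K) := by
    rw [RingHom.map_field_closure, Finset.coe_image, Finset.coe_image, Set.image_union]
    rfl
  have hdef : IsDefinedOver (Subfield.closure (↑(F₀'.image ε.symm) : Set K)) W :=
    hdef'.image_comp ε.symm hF₀
  -- SEAC in `K`
  obtain ⟨z, ⟨hzW, hzexp⟩, hgen⟩ :=
    h n W hirr hne hrot hadd hmul hdim (A'.image ε.symm) (F₀'.image ε.symm) hdef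
  -- push the generic point forward along `ε`
  refine ⟨⇑ε ∘ z, ⟨hWimg ▸ ⟨z, hzW, rfl⟩, ?_⟩, ?_⟩
  · have hz' : (⇑ε ∘ z) ∈ (fun w : Fin n ⊕ Fin n → K => ⇑ε ∘ w) '' expGraph K n := ⟨z, hzexp, rfl⟩
    rwa [hε, image_comp_expGraph] at hz'
  · have hF' : (Subfield.closure (↑A' ∪ ↑F₀' : Set K')).map (ε.symm : K' →+* K) ≤
        Subfield.closure (↑(A'.image ε.symm) ∪ ↑(F₀'.image ε.symm) : Set K) := hF
    have := hgen.image_comp ε hF'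
    rwa [hWimg] at this

/-- **Zilber's axioms are invariant under isomorphisms of exponential fields.** If `K` is a
Zilber field (`IsZilberField K`: ACF₀, standard kernel, `exp` onto `Kˣ`, Schanuel property,
strong exponential-algebraic closedness, countable closure property) and `e : K ≃ K'` is an E-ring
isomorphism, then `K'` is a Zilber field. This is the transport-of-structure step behind reading
Zilber's categoricity theorem (Zilber 2005, Thm 1.1; Bays–Kirby 2018, Thm 1.2: the models of
`ECF_{SK,CCP}` of a given uncountable cardinality are unique *up to isomorphism*) and Bays–Kirby's
Conjecture 1.3 ("`ℂ_exp` is isomorphic to `𝔹`") as statements about `ℂ_exp` itself. Components: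
`isAlgClosed_of_ringEquiv`, `HasStandardKernel.of_exponentialRingEquiv`,
`IsSurjectiveOntoUnits.of_exponentialRingEquiv`, `SchanuelProperty.of_injective_holds` (for
`e⁻¹`), `IsStronglyExpAlgClosed.of_exponentialRingEquiv`,
`HasCountableClosureProperty.of_exponentialRingEquiv`. [folklore] -/
theorem IsZilberField.of_exponentialRingEquiv {K : Type u} {K' : Type v} [Field K] [CharZero K]
    [ExponentialRing K] [Field K'] [CharZero K'] [ExponentialRing K']
    (e : ExponentialRingEquiv K K') (hK : IsZilberField K) : IsZilberField K' where
  isAlgClosed := isAlgClosed_of_ringEquiv e.toRingEquiv hK.isAlgClosed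
  hasStandardKernel := hK.hasStandardKernel.of_exponentialRingEquiv e
  isSurjectiveOntoUnits := hK.isSurjectiveOntoUnits.of_exponentialRingEquiv e
  schanuelProperty :=
    SchanuelProperty.of_injective_holds e.symm.toExponentialRingHom hK.schanuelProperty
  isStronglyExpAlgClosed := hK.isStronglyExpAlgClosed.of_exponentialRingEquiv e
  hasCountableClosureProperty := hK.hasCountableClosureProperty.of_exponentialRingEquiv e

/-- Being a Zilber field is a property of the isomorphism type of an exponential field.
[folklore] -/
theorem ExponentialRingEquiv.isZilberField_iff {K : Type u} {K' : Type v} [Field K] [CharZero K]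
    [ExponentialRing K] [Field K'] [CharZero K'] [ExponentialRing K']
    (e : ExponentialRingEquiv K K') : IsZilberField K ↔ IsZilberField K' :=
  ⟨IsZilberField.of_exponentialRingEquiv e, IsZilberField.of_exponentialRingEquiv e.symm⟩

end ERingTransport

end Literature.NumberTheory.Transcendental
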